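import Summits.QuantumFields.YangMills.Theorems.FluctuationComparisonRegPrIntLOrganTangentBidiscDoubleDifference
import Summits.QuantumFields.YangMills.Theorems.FluctuationComparisonRegPrIntLOrganTangentResolventDoubleDifference
import HarnessLib

/-!
# Route `UnitScaleTilt`, crux stmt-QuantumFields-20520 `FluctuationComparisonRegPrIntL`, PATH-B organ (covariant organ of record, RULING №56),
# group (I-curv) ∕ SPEC v1.8 (xv) — **THE ONE-LOOP LETTERS FROM HOLOMORPHY**: the Cauchy knit into ✓p827474 `…OrganTangentResolventDoubleDifference`.
# Its difference letters `k₁ k₂ k₁₂ h₁ h₂ h₁₂` (sizes of the first and mixed second differences of the one-loop operators `K`, `H` over a near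
# coarse two-bond square of move sizes `s, t`) are SUPPLIED from «`(σ, τ) ↦ K σ τ`, `H σ τ` separately holomorphic and bounded on a bidisc of radii
# `(ρ, ρ′)` in the two complexified coarse parameters» by this lineage's ✓p822180 `…OrganTangentBidiscDoubleDifference` (two-step Cauchy, the
# one-parameter template of [Balaban1987RG1] (3.15)–(3.17) p.273 ∕ (3.54) p.280 applied twice — UV3-NODE §80's «CAUCHY ROAD»), rescaled to physical
# move sizes `0 ≤ s ≤ ρ∕4`, `0 ≤ t ≤ ρ′∕4`: `k₁ = 4M_K∕ρ`, `k₂ = 4M_K∕ρ′`, `k₁₂ = 16M_K∕(ρρ′)` (same for `H`), hence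
# `‖ΔΔ(K⁻¹H)‖ ≤ C(a, M_K, M_H, ρ, ρ′)·s·t` with `C` an explicit polynomial.

Cell `ym3-torus`, WIDTH COPY «width 19» of ★p1 (seat `ym3-torus-px19`, gen 23); `--supports stmt-QuantumFields-20520 --as helper`; count-neutral;
def-free.  INHABITATION (★★OWNER RULING №100): LAW-FREE — `K σ τ = K_{V(σ,τ)}`, `H σ τ = H^O_{V(σ,τ)}` along the COMPLEXIFIED near coarse two-bond
square `V(σ,τ) = V·expPointC(σ•ŵ)@b·expPointC(τ•ŵ′)@b′` (✓p827459's slice device); own analyticity of the chart objects; no fibre law, no score.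

WHAT THIS FILE PROVES (sorry-free; `F` any complex normed space, `R` any complex normed algebra).
* §1 ★`norm_sub_le_of_holo` — ONE MOVE: `f : ℂ → F` holomorphic on `ball 0 ρ` with `‖f‖ ≤ M` there ⟹ `‖f s − f 0‖ ≤ (4M∕ρ)·s` for real `0 ≤ s ≤ ρ∕4`
  (✓`norm_sub_le_of_osc` on `σ ↦ f(σ·s)`, disc of radius `ρ∕s ≥ 4`).
* §2 ★★`norm_doubleDiff_le_of_holo_bidisc` — THE SQUARE: `𝒦 : ℂ → ℂ → F` separately holomorphic on `ball 0 ρ × ball 0 ρ′` with `‖𝒦‖ ≤ M` there ⟹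
  `‖𝒦 s t − 𝒦 s 0 − 𝒦 0 t + 𝒦 0 0‖ ≤ (16M∕(ρρ′))·s·t` for real `0 ≤ s ≤ ρ∕4`, `0 ≤ t ≤ ρ′∕4` (✓`norm_doubleDiff_le_of_sep_holo` on
  `(σ,τ) ↦ 𝒦(σ·s)(τ·t)`).
* §3 ★★★`norm_doubleDiff_inv_mul_le_of_holo` — THE KNIT: `K, H : ℂ → ℂ → R` separately holomorphic with `‖K‖ ≤ M_K`, `‖H‖ ≤ M_H` on the bidisc,
  two-sided inverses `A₀₀ A₁₀ A₀₁ A₁₁` of `K` at the four REAL corners `(0,0), (s,0), (0,t), (s,t)` with `‖A‖ ≤ a` ⟹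
  `‖A₁₁·H s t − A₁₀·H s 0 − A₀₁·H 0 t + A₀₀·H 0 0‖ ≤ (a·h₁₂ + a²(k₁h₂ + k₂h₁) + (a²k₁₂ + 2a³k₁k₂)·M_H)·s·t` at the letters above
  (= ✓`norm_doubleDiff_inv_mul_le` by name); ★★`abs_doubleDiff_functional_le_of_holo` — through any bounded additive functional `φ` (a trace).

WHAT STAYS FOR THE DISCHARGER (LEAD №20's layer (2), untouched): the m-UNIFORMITY of `(M_K, M_H, ρ, ρ′, a)` and the `tdist`-decay after the trace
([Balaban1984PropagatorsII] ∕ [Balaban1985BackgroundPropagators]); the chart's analyticity supplying `K_{V(σ,τ)}`, `H^O_{V(σ,τ)}` as holomorphic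
families ([Balaban1985Variational] Prop. 9; [Balaban1987RG1] (1.5), p.261).  HONEST SCOPE: generic complex analysis + normed-ring algebra knit;
nothing of Bałaban's operators constructed; (xv) ∕ (I-curv), `OrganDischargeInputsHJ(sq)` v0.1–v0.4 ∕ `SpreadFibreLawH(J)(sq)` UNDISCHARGED; the five
registered stubs, 20520, 19936, 19200, `YM3TorusSU2` NOT proved; no summit is proved by a helper.  R3 = SU(2) YM₃ on T³ — NOT d = 4, NOT infinite
volume, NOT a mass gap, NOT Clay; the Yang–Mills mass gap is NOT proved.

References: T. Bałaban, CMP **109** (1987) 249–301 [Balaban1987RG1] ((3.15)–(3.17) p.273, (3.54) p.280); CMP **96** (1984) 223–250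
[Balaban1984PropagatorsII]; CMP **99** (1985) 389–434 [Balaban1985BackgroundPropagators].
-/

noncomputable section

open Metric Set
open Summit.QuantumFields.YangMills.Theorems.OrganTangentBidiscDoubleDifference (norm_sub_le_of_osc norm_doubleDiff_le_of_sep_holo)
open Summit.QuantumFields.YangMills.Theorems.OrganTangentResolventDoubleDifference (norm_doubleDiff_inv_mul_le abs_doubleDiff_functional_le)

namespace Summit.QuantumFields.YangMills.Theorems.OrganTangentOneLoopLettersOfHolomorphy

/-! ## §0 Rescaling bookkeeping -/

/-- For `0 < s ≤ ρ∕4`: the rescaled radius `ρ∕s` exceeds `1 + (ρ∕s − 2)`, the margin `ρ∕s − 2` is positive and `≥ ρ∕(2s)`, so `1∕(ρ∕s − 2) ≤ 2s∕ρ`.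
[folklore] -/
theorem rescale_margin {ρ s : ℝ} (hs : 0 < s) (hsρ : s ≤ ρ / 4) :
    0 < ρ / s - 2 ∧ 1 + (ρ / s - 2) < ρ / s ∧ 1 / (ρ / s - 2) ≤ 2 * s / ρ := by
  have hρ : 0 < ρ := by linarith
  have h4 : 4 ≤ ρ / s := by rw [le_div_iff₀ hs]; linarith
  refine ⟨by linarith, by linarith, ?_⟩
  rw [div_le_div_iff₀ (by linarith) hρ]
  have : ρ / s * s = ρ := div_mul_cancel₀ ρ hs.ne'
  nlinarith [this]

/-- The real scaling map `σ ↦ σ·s` sends `ball 0 (ρ∕s)` into `ball 0 ρ` (`s > 0`). [folklore] -/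
theorem mapsTo_mul_ball {ρ s : ℝ} (hs : 0 < s) :
    MapsTo (fun σ : ℂ => σ * (s : ℂ)) (ball (0 : ℂ) (ρ / s)) (ball (0 : ℂ) ρ) := by
  intro σ hσ
  rw [mem_ball_zero_iff] at hσ ⊢
  rw [norm_mul, Complex.norm_real, Real.norm_eq_abs, abs_of_pos hs]
  calc ‖σ‖ * s < ρ / s * s := mul_lt_mul_of_pos_right hσ hs
    _ = ρ := div_mul_cancel₀ ρ hs.ne'

variable {F : Type*} [NormedAddCommGroup F] [NormedSpace ℂ F]

/-! ## §1 One move: `‖f s − f 0‖ ≤ (4M∕ρ)·s` -/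

/-- ★ **ONE MOVE FROM HOLOMORPHY**: `f` holomorphic on `ball 0 ρ` with `‖f z‖ ≤ M` there ⟹ `‖f s − f 0‖ ≤ (4M∕ρ)·s` for real `0 ≤ s ≤ ρ∕4`.
[cite: Balaban1987RG1, (3.15)-(3.17) p.273] -/
theorem norm_sub_le_of_holo {f : ℂ → F} {ρ M : ℝ} (hf : DifferentiableOn ℂ f (ball (0 : ℂ) ρ))
    (hM : ∀ z ∈ ball (0 : ℂ) ρ, ‖f z‖ ≤ M) {s : ℝ} (hs0 : 0 ≤ s) (hsρ : s ≤ ρ / 4) :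
    ‖f (s : ℂ) - f 0‖ ≤ (4 * M / ρ) * s := by
  rcases hs0.eq_or_lt with rfl | hs
  · simp
  have hρ : 0 < ρ := by linarith
  have hM0 : 0 ≤ M := (norm_nonneg _).trans (hM 0 (mem_ball_self hρ))
  obtain ⟨hr, hrR, hinv⟩ := rescale_margin hs hsρ
  -- the rescaled function
  have hg : DifferentiableOn ℂ (fun σ : ℂ => f (σ * (s : ℂ))) (ball (0 : ℂ) (ρ / s)) :=
    hf.comp ((differentiableOn_id).mul_const _) (mapsTo_mul_ball hs)
  have hosc : ∀ τ ∈ ball (0 : ℂ) (ρ / s), ∀ τ' ∈ ball (0 : ℂ) (ρ / s),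
      ‖f (τ * (s : ℂ)) - f (τ' * (s : ℂ))‖ ≤ 2 * M := by
    intro τ hτ τ' hτ'
    calc ‖f (τ * (s : ℂ)) - f (τ' * (s : ℂ))‖ ≤ ‖f (τ * (s : ℂ))‖ + ‖f (τ' * (s : ℂ))‖ := norm_sub_le _ _
      _ ≤ M + M := add_le_add (hM _ (mapsTo_mul_ball hs hτ)) (hM _ (mapsTo_mul_ball hs hτ'))
      _ = 2 * M := by ring
  have h := norm_sub_le_of_osc (f := fun σ : ℂ => f (σ * (s : ℂ))) hr hrR hg hosc
  simp only [one_mul, zero_mul] at h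
  calc ‖f (s : ℂ) - f 0‖ ≤ 2 * M / (ρ / s - 2) := h
    _ = 2 * M * (1 / (ρ / s - 2)) := by rw [mul_one_div]
    _ ≤ 2 * M * (2 * s / ρ) := mul_le_mul_of_nonneg_left hinv (by positivity)
    _ = (4 * M / ρ) * s := by ring

/-! ## §2 The square: `‖ΔΔ𝒦‖ ≤ (16M∕(ρρ′))·s·t` -/

/-- ★★ **THE DOUBLE DIFFERENCE FROM SEPARATE HOLOMORPHY**: `𝒦 : ℂ → ℂ → F` with every `σ`-slice holomorphic on `ball 0 ρ` (for `τ ∈ ball 0 ρ′`),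
every `τ`-slice holomorphic on `ball 0 ρ′` (for `σ ∈ ball 0 ρ`), and `‖𝒦 σ τ‖ ≤ M` on the bidisc ⟹ for real `0 ≤ s ≤ ρ∕4`, `0 ≤ t ≤ ρ′∕4`:
`‖𝒦 s t − 𝒦 s 0 − 𝒦 0 t + 𝒦 0 0‖ ≤ (16M∕(ρρ′))·s·t`. [cite: Balaban1987RG1, (3.15)-(3.17) p.273 and (3.54) p.280] -/
theorem norm_doubleDiff_le_of_holo_bidisc {𝒦 : ℂ → ℂ → F} {ρ ρ' M : ℝ}
    (hσ : ∀ τ ∈ ball (0 : ℂ) ρ', DifferentiableOn ℂ (fun σ => 𝒦 σ τ) (ball (0 : ℂ) ρ))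
    (hτ : ∀ σ ∈ ball (0 : ℂ) ρ, DifferentiableOn ℂ (𝒦 σ) (ball (0 : ℂ) ρ'))
    (hM : ∀ σ ∈ ball (0 : ℂ) ρ, ∀ τ ∈ ball (0 : ℂ) ρ', ‖𝒦 σ τ‖ ≤ M)
    {s t : ℝ} (hs0 : 0 ≤ s) (hsρ : s ≤ ρ / 4) (ht0 : 0 ≤ t) (htρ : t ≤ ρ' / 4) :
    ‖𝒦 (s : ℂ) (t : ℂ) - 𝒦 (s : ℂ) 0 - 𝒦 0 (t : ℂ) + 𝒦 0 0‖ ≤ (16 * M / (ρ * ρ')) * s * t := by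
  rcases hs0.eq_or_lt with rfl | hs
  · simp
  rcases ht0.eq_or_lt with rfl | ht
  · simp
  have hρ : 0 < ρ := by linarith
  have hρ' : 0 < ρ' := by linarith
  have hM0 : 0 ≤ M := (norm_nonneg _).trans (hM 0 (mem_ball_self hρ) 0 (mem_ball_self hρ'))
  obtain ⟨hr, hrR, hinv⟩ := rescale_margin hs hsρ
  obtain ⟨hr', hr'R', hinv'⟩ := rescale_margin ht htρ
  -- the rescaled two-parameter family `H σ τ := 𝒦 (σ·s) (τ·t)`
  have hmaps := mapsTo_mul_ball (ρ := ρ) hs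
  have hmaps' := mapsTo_mul_ball (ρ := ρ') ht
  have h0t : (0 : ℂ) * (t : ℂ) ∈ ball (0 : ℂ) ρ' := by rw [zero_mul]; exact mem_ball_self hρ'
  have h1t : (1 : ℂ) * (t : ℂ) ∈ ball (0 : ℂ) ρ' := by
    apply hmaps'; rw [mem_ball_zero_iff, norm_one]; linarith
  have hH0 : DifferentiableOn ℂ (fun σ : ℂ => 𝒦 (σ * (s : ℂ)) ((0 : ℂ) * (t : ℂ))) (ball (0 : ℂ) (ρ / s)) :=
    (hσ _ h0t).comp ((differentiableOn_id).mul_const _) hmaps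
  have hH1 : DifferentiableOn ℂ (fun σ : ℂ => 𝒦 (σ * (s : ℂ)) ((1 : ℂ) * (t : ℂ))) (ball (0 : ℂ) (ρ / s)) :=
    (hσ _ h1t).comp ((differentiableOn_id).mul_const _) hmaps
  have hHτ : ∀ σ ∈ ball (0 : ℂ) (ρ / s),
      DifferentiableOn ℂ (fun τ : ℂ => 𝒦 (σ * (s : ℂ)) (τ * (t : ℂ))) (ball (0 : ℂ) (ρ' / t)) := fun σ hσ' =>
    (hτ _ (hmaps hσ')).comp ((differentiableOn_id).mul_const _) hmaps'
  have hHM : ∀ σ ∈ ball (0 : ℂ) (ρ / s), ∀ τ ∈ ball (0 : ℂ) (ρ' / t), ∀ τ' ∈ ball (0 : ℂ) (ρ' / t),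
      ‖𝒦 (σ * (s : ℂ)) (τ * (t : ℂ)) - 𝒦 (σ * (s : ℂ)) (τ' * (t : ℂ))‖ ≤ 2 * M := by
    intro σ hσ' τ hτ' τ' hτ''
    calc ‖𝒦 (σ * (s : ℂ)) (τ * (t : ℂ)) - 𝒦 (σ * (s : ℂ)) (τ' * (t : ℂ))‖
        ≤ ‖𝒦 (σ * (s : ℂ)) (τ * (t : ℂ))‖ + ‖𝒦 (σ * (s : ℂ)) (τ' * (t : ℂ))‖ := norm_sub_le _ _
      _ ≤ M + M := add_le_add (hM _ (hmaps hσ') _ (hmaps' hτ')) (hM _ (hmaps hσ') _ (hmaps' hτ''))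
      _ = 2 * M := by ring
  have h := norm_doubleDiff_le_of_sep_holo (H := fun σ τ : ℂ => 𝒦 (σ * (s : ℂ)) (τ * (t : ℂ)))
    hr hrR hr' hr'R' hH0 hH1 hHτ hHM
  simp only [one_mul, zero_mul] at h
  calc ‖𝒦 (s : ℂ) (t : ℂ) - 𝒦 (s : ℂ) 0 - 𝒦 0 (t : ℂ) + 𝒦 0 0‖ ≤ 2 * (2 * M) / ((ρ / s - 2) * (ρ' / t - 2)) := h
    _ = 4 * M * ((1 / (ρ / s - 2)) * (1 / (ρ' / t - 2))) := by
        rw [one_div_mul_one_div, mul_one_div]; ring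
    _ ≤ 4 * M * ((2 * s / ρ) * (2 * t / ρ')) := by
        apply mul_le_mul_of_nonneg_left _ (by positivity)
        exact mul_le_mul hinv hinv' (by positivity) (by positivity)
    _ = (16 * M / (ρ * ρ')) * s * t := by ring

/-! ## §3 The knit into ✓p827474: the one-loop letters from holomorphy -/

section Knit

variable {R : Type*} [NormedRing R] [NormedAlgebra ℂ R]

/-- ★★★ **THE ONE-LOOP BILINEAR BOUND FROM HOLOMORPHY** (= ✓`norm_doubleDiff_inv_mul_le` with its letters supplied by §1–§2).  `K, H : ℂ → ℂ → R`
separately holomorphic on the bidisc `ball 0 ρ × ball 0 ρ′` with `‖K σ τ‖ ≤ M_K`, `‖H σ τ‖ ≤ M_H` there; move sizes `0 ≤ s ≤ ρ∕4`, `0 ≤ t ≤ ρ′∕4`;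
two-sided inverses `A₀₀, A₁₀, A₀₁, A₁₁` of `K` at the real corners `(0,0), (s,0), (0,t), (s,t)` with norms `≤ a` (`ρ, ρ′ > 0`) ⟹
`‖A₁₁·H s t − A₁₀·H s 0 − A₀₁·H 0 t + A₀₀·H 0 0‖ ≤ (a·h₁₂ + a²·(k₁·h₂ + k₂·h₁) + (a²·k₁₂ + 2·a³·k₁·k₂)·M_H)·s·t` with
`k₁ = 4M_K∕ρ`, `k₂ = 4M_K∕ρ′`, `k₁₂ = 16M_K∕(ρρ′)`, `h₁ = 4M_H∕ρ`, `h₂ = 4M_H∕ρ′`, `h₁₂ = 16M_H∕(ρρ′)`.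
[cite: Balaban1987RG1, (3.15)-(3.17) p.273 and (3.54) p.280] -/
theorem norm_doubleDiff_inv_mul_le_of_holo {K H : ℂ → ℂ → R} {ρ ρ' MK MH a : ℝ} (hρ : 0 < ρ) (hρ' : 0 < ρ')
    (hKσ : ∀ τ ∈ ball (0 : ℂ) ρ', DifferentiableOn ℂ (fun σ => K σ τ) (ball (0 : ℂ) ρ))
    (hKτ : ∀ σ ∈ ball (0 : ℂ) ρ, DifferentiableOn ℂ (K σ) (ball (0 : ℂ) ρ'))
    (hKM : ∀ σ ∈ ball (0 : ℂ) ρ, ∀ τ ∈ ball (0 : ℂ) ρ', ‖K σ τ‖ ≤ MK)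
    (hHσ : ∀ τ ∈ ball (0 : ℂ) ρ', DifferentiableOn ℂ (fun σ => H σ τ) (ball (0 : ℂ) ρ))
    (hHτ : ∀ σ ∈ ball (0 : ℂ) ρ, DifferentiableOn ℂ (H σ) (ball (0 : ℂ) ρ'))
    (hHM : ∀ σ ∈ ball (0 : ℂ) ρ, ∀ τ ∈ ball (0 : ℂ) ρ', ‖H σ τ‖ ≤ MH)
    {s t : ℝ} (hs0 : 0 ≤ s) (hsρ : s ≤ ρ / 4) (ht0 : 0 ≤ t) (htρ : t ≤ ρ' / 4)
    {A₀₀ A₁₀ A₀₁ A₁₁ : R}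
    (hl₀₀ : A₀₀ * K 0 0 = 1) (hr₀₀ : K 0 0 * A₀₀ = 1)
    (hl₁₀ : A₁₀ * K (s : ℂ) 0 = 1) (hr₁₀ : K (s : ℂ) 0 * A₁₀ = 1)
    (hl₀₁ : A₀₁ * K 0 (t : ℂ) = 1) (hr₀₁ : K 0 (t : ℂ) * A₀₁ = 1)
    (hl₁₁ : A₁₁ * K (s : ℂ) (t : ℂ) = 1) (hr₁₁ : K (s : ℂ) (t : ℂ) * A₁₁ = 1)
    (hA₀₀ : ‖A₀₀‖ ≤ a) (hA₁₀ : ‖A₁₀‖ ≤ a) (hA₀₁ : ‖A₀₁‖ ≤ a) (hA₁₁ : ‖A₁₁‖ ≤ a) :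
    ‖A₁₁ * H (s : ℂ) (t : ℂ) - A₁₀ * H (s : ℂ) 0 - A₀₁ * H 0 (t : ℂ) + A₀₀ * H 0 0‖ ≤
      (a * (16 * MH / (ρ * ρ')) + a ^ 2 * ((4 * MK / ρ) * (4 * MH / ρ') + (4 * MK / ρ') * (4 * MH / ρ)) +
        (a ^ 2 * (16 * MK / (ρ * ρ')) + 2 * a ^ 3 * (4 * MK / ρ) * (4 * MK / ρ')) * MH) * s * t := by
  have h0ρ : (0 : ℂ) ∈ ball (0 : ℂ) ρ := mem_ball_self hρ
  have h0ρ' : (0 : ℂ) ∈ ball (0 : ℂ) ρ' := mem_ball_self hρ'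
  have hsρm : (s : ℂ) ∈ ball (0 : ℂ) ρ := by
    rw [mem_ball_zero_iff, Complex.norm_real, Real.norm_eq_abs, abs_of_nonneg hs0]; linarith
  have htρm : (t : ℂ) ∈ ball (0 : ℂ) ρ' := by
    rw [mem_ball_zero_iff, Complex.norm_real, Real.norm_eq_abs, abs_of_nonneg ht0]; linarith
  have hMK0 : 0 ≤ MK := (norm_nonneg _).trans (hKM 0 h0ρ 0 h0ρ')
  have hMH0 : 0 ≤ MH := (norm_nonneg _).trans (hHM 0 h0ρ 0 h0ρ')
  -- the letters
  have hK1a : ‖K (s : ℂ) 0 - K 0 0‖ ≤ (4 * MK / ρ) * s :=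
    norm_sub_le_of_holo (hKσ 0 h0ρ') (fun z hz => hKM z hz 0 h0ρ') hs0 hsρ
  have hK1b : ‖K (s : ℂ) (t : ℂ) - K 0 (t : ℂ)‖ ≤ (4 * MK / ρ) * s :=
    norm_sub_le_of_holo (hKσ _ htρm) (fun z hz => hKM z hz _ htρm) hs0 hsρ
  have hK2a : ‖K 0 (t : ℂ) - K 0 0‖ ≤ (4 * MK / ρ') * t :=
    norm_sub_le_of_holo (hKτ 0 h0ρ) (fun z hz => hKM 0 h0ρ z hz) ht0 htρ
  have hK2b : ‖K (s : ℂ) (t : ℂ) - K (s : ℂ) 0‖ ≤ (4 * MK / ρ') * t :=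
    norm_sub_le_of_holo (hKτ _ hsρm) (fun z hz => hKM _ hsρm z hz) ht0 htρ
  have hK12 : ‖K (s : ℂ) (t : ℂ) - K (s : ℂ) 0 - K 0 (t : ℂ) + K 0 0‖ ≤ (16 * MK / (ρ * ρ')) * s * t :=
    norm_doubleDiff_le_of_holo_bidisc hKσ hKτ hKM hs0 hsρ ht0 htρ
  have hH1 : ‖H (s : ℂ) 0 - H 0 0‖ ≤ (4 * MH / ρ) * s :=
    norm_sub_le_of_holo (hHσ 0 h0ρ') (fun z hz => hHM z hz 0 h0ρ') hs0 hsρ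
  have hH2 : ‖H 0 (t : ℂ) - H 0 0‖ ≤ (4 * MH / ρ') * t :=
    norm_sub_le_of_holo (hHτ 0 h0ρ) (fun z hz => hHM 0 h0ρ z hz) ht0 htρ
  have hH12 : ‖H (s : ℂ) (t : ℂ) - H (s : ℂ) 0 - H 0 (t : ℂ) + H 0 0‖ ≤ (16 * MH / (ρ * ρ')) * s * t :=
    norm_doubleDiff_le_of_holo_bidisc hHσ hHτ hHM hs0 hsρ ht0 htρ
  exact norm_doubleDiff_inv_mul_le hl₀₀ hr₀₀ hl₀₁ hr₀₁ hl₁₀ hr₁₀ hl₁₁ hr₁₁ hA₀₀ hA₀₁ hA₁₀ hA₁₁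
    (hHM 0 h0ρ 0 h0ρ') hs0 ht0 (by positivity) (by positivity) hK1a hK1b hK2a hK2b hK12 hH1 hH2 hH12

/-- ★★ **THROUGH A BOUNDED ADDITIVE FUNCTIONAL** (a trace, a matrix entry, a localised trace; ✓`abs_doubleDiff_functional_le` with the letters of
§1–§2): `|φ(A₁₁H s t) − φ(A₁₀H s 0) − φ(A₀₁H 0 t) + φ(A₀₀H 0 0)| ≤ c·(…)·s·t`. [cite: Balaban1987RG1, (3.15)-(3.17) p.273 and (3.54) p.280] -/
theorem abs_doubleDiff_functional_le_of_holo {K H : ℂ → ℂ → R} {ρ ρ' MK MH a c : ℝ}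
    (φ : R →+ ℝ) (hc : 0 ≤ c) (hφ : ∀ x, |φ x| ≤ c * ‖x‖) (hρ : 0 < ρ) (hρ' : 0 < ρ')
    (hKσ : ∀ τ ∈ ball (0 : ℂ) ρ', DifferentiableOn ℂ (fun σ => K σ τ) (ball (0 : ℂ) ρ))
    (hKτ : ∀ σ ∈ ball (0 : ℂ) ρ, DifferentiableOn ℂ (K σ) (ball (0 : ℂ) ρ'))
    (hKM : ∀ σ ∈ ball (0 : ℂ) ρ, ∀ τ ∈ ball (0 : ℂ) ρ', ‖K σ τ‖ ≤ MK)
    (hHσ : ∀ τ ∈ ball (0 : ℂ) ρ', DifferentiableOn ℂ (fun σ => H σ τ) (ball (0 : ℂ) ρ))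
    (hHτ : ∀ σ ∈ ball (0 : ℂ) ρ, DifferentiableOn ℂ (H σ) (ball (0 : ℂ) ρ'))
    (hHM : ∀ σ ∈ ball (0 : ℂ) ρ, ∀ τ ∈ ball (0 : ℂ) ρ', ‖H σ τ‖ ≤ MH)
    {s t : ℝ} (hs0 : 0 ≤ s) (hsρ : s ≤ ρ / 4) (ht0 : 0 ≤ t) (htρ : t ≤ ρ' / 4)
    {A₀₀ A₁₀ A₀₁ A₁₁ : R}
    (hl₀₀ : A₀₀ * K 0 0 = 1) (hr₀₀ : K 0 0 * A₀₀ = 1)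
    (hl₁₀ : A₁₀ * K (s : ℂ) 0 = 1) (hr₁₀ : K (s : ℂ) 0 * A₁₀ = 1)
    (hl₀₁ : A₀₁ * K 0 (t : ℂ) = 1) (hr₀₁ : K 0 (t : ℂ) * A₀₁ = 1)
    (hl₁₁ : A₁₁ * K (s : ℂ) (t : ℂ) = 1) (hr₁₁ : K (s : ℂ) (t : ℂ) * A₁₁ = 1)
    (hA₀₀ : ‖A₀₀‖ ≤ a) (hA₁₀ : ‖A₁₀‖ ≤ a) (hA₀₁ : ‖A₀₁‖ ≤ a) (hA₁₁ : ‖A₁₁‖ ≤ a) :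
    |φ (A₁₁ * H (s : ℂ) (t : ℂ)) - φ (A₁₀ * H (s : ℂ) 0) - φ (A₀₁ * H 0 (t : ℂ)) + φ (A₀₀ * H 0 0)| ≤
      c * (a * (16 * MH / (ρ * ρ')) + a ^ 2 * ((4 * MK / ρ) * (4 * MH / ρ') + (4 * MK / ρ') * (4 * MH / ρ)) +
        (a ^ 2 * (16 * MK / (ρ * ρ')) + 2 * a ^ 3 * (4 * MK / ρ) * (4 * MK / ρ')) * MH) * s * t := by
  have hmap : φ (A₁₁ * H (s : ℂ) (t : ℂ)) - φ (A₁₀ * H (s : ℂ) 0) - φ (A₀₁ * H 0 (t : ℂ)) + φ (A₀₀ * H 0 0)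
      = φ (A₁₁ * H (s : ℂ) (t : ℂ) - A₁₀ * H (s : ℂ) 0 - A₀₁ * H 0 (t : ℂ) + A₀₀ * H 0 0) := by
    simp only [map_sub, map_add]
  rw [hmap]
  have hmain := norm_doubleDiff_inv_mul_le_of_holo hρ hρ' hKσ hKτ hKM hHσ hHτ hHM hs0 hsρ ht0 htρ
    hl₀₀ hr₀₀ hl₁₀ hr₁₀ hl₀₁ hr₀₁ hl₁₁ hr₁₁ hA₀₀ hA₁₀ hA₀₁ hA₁₁
  calc |φ (A₁₁ * H (s : ℂ) (t : ℂ) - A₁₀ * H (s : ℂ) 0 - A₀₁ * H 0 (t : ℂ) + A₀₀ * H 0 0)|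
      ≤ c * ‖A₁₁ * H (s : ℂ) (t : ℂ) - A₁₀ * H (s : ℂ) 0 - A₀₁ * H 0 (t : ℂ) + A₀₀ * H 0 0‖ := hφ _
    _ ≤ c * ((a * (16 * MH / (ρ * ρ')) + a ^ 2 * ((4 * MK / ρ) * (4 * MH / ρ') + (4 * MK / ρ') * (4 * MH / ρ)) +
        (a ^ 2 * (16 * MK / (ρ * ρ')) + 2 * a ^ 3 * (4 * MK / ρ) * (4 * MK / ρ')) * MH) * s * t) :=
        mul_le_mul_of_nonneg_left hmain hc
    _ = _ := by ring

end Knit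

end Summit.QuantumFields.YangMills.Theorems.OrganTangentOneLoopLettersOfHolomorphy
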